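import Mathlib.RepresentationTheory.Basic
import Mathlib.Algebra.Algebra.Subalgebra.Basic
import Mathlib.NumberTheory.HeckeRing.Defs
import Mathlib.GroupTheory.DoubleCoset
import Mathlib.Algebra.BigOperators.Finprod
import Mathlib.MeasureTheory.Measure.Haar.Basic
import Mathlib.MeasureTheory.Integral.Bochner.Basic
import Mathlib.GroupTheory.Commensurable
import Mathlib.LinearAlgebra.Basis.Defs
import Literature.NumberTheory.Automorphic.SmoothRepresentation
import HarnessLib

-- provenance: harness21/H21/H21/Prelude/AutomorphicAxiomatic/HeckeAlgebra.lean @ 0c3bcbe (interim HEAD d8f2665); M5 mechanical rewrite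
/-!
# Hecke algebras of a pair `(G, K)` (trunk: AutomorphicAxiomatic)

Let `G` be a group, `K ≤ G` a subgroup and `k` a commutative ring. The *Hecke algebra*
`ℋ(G, K)` is classically the convolution algebra of compactly supported bi-`K`-invariant
functions `G → k` when `G` is locally profinite and `K` is compact open
(Bushnell–Henniart, *The local Langlands conjecture for `GL(2)`*, §4.1; Cartier,
*Representations of `p`-adic groups*, Corvallis 1979, §I–IV). Abstractly it only needs the
*Hecke pair* condition "every double coset `KgK` is a finite union of left cosets", i.e.
`K` and `gKg⁻¹` are commensurable for all `g` (Shimura, Chapter 3).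

## Design

* Mathlib's `HeckeRing Δ H Z` (`Mathlib/NumberTheory/HeckeRing/Defs.lean`) is, in this Mathlib
  snapshot, only the free module on double cosets: it carries no product and not even a
  `Module Z` instance. We do **not** put a ring structure on it. Instead the honest, proof-free
  algebra is `heckeAlgebra k G K := End_G(k[G ⧸ K])`, the commutant of the permutation
  representation `Representation.ofMulAction k G (G ⧸ K)` (`= c-Ind_K^G 𝟙`), realised as
  `Subalgebra.centralizer`; `Ring`/`Algebra k` instances are Mathlib's. Since `End_G(c-Ind 𝟙)`
  is *anti*-isomorphic to the convolution algebra (right convolutions commute with left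
  translations), the action on `K`-fixed vectors is an algebra map out of
  `(heckeAlgebra k G K)ᵐᵒᵖ` (`exists_algHom_moduleEnd_fixedPoints`).
* The finiteness hypothesis is Mathlib's Hecke-pair class
  `[IsHeckeTriple (⊤ : Submonoid G) K K]`, equivalent to
  `Subgroup.Commensurable.commensurator K = ⊤` (`isHeckeTriple_top_of_commensurator_eq_top`);
  compact open subgroups of topological groups satisfy it
  (`isHeckeTriple_top_of_isCompact_isOpen`).
* Concrete Hecke operators on any representation `ρ`: `heckeOperator ρ K g = ∑_{y ∈ KgK/K} ρ(y)`,
  a `finsum` over the `K`-orbit of `gK` in `G ⧸ K` with chosen representatives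
  (`Quotient.out`). It is representative-independent on `V^K = ρ.fixedPoints K`
  (`heckeOperator_apply_eq_sum`); off `V^K`, and when `KgK/K` is infinite (junk value `0` of
  `finsum`), its value is junk. This is documented on the definition.
* `IsGelfandPair k G K` ("`ℋ(G, K)` is commutative") is a *predicate* with explicit binders, not a
  named fact: its universal closure is refuted by `not_isGelfandPair_bot` (`GelfandPair.lean`,
  which also proves Gelfand's lemma), and the `GLₙ` instance is
  `SatakeParametersGL.isGelfandPair_glInt_holds` (2026-08-15 verdict clean-up; statement unchanged).
* Comparison statements, stated as named facts (`def … : Prop`, D-0014) each carrying the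
  Hecke-pair hypothesis as an explicit binder `[IsHeckeTriple ⊤ K K]` of its own signature (a
  `def`, unlike a `theorem`, silently drops an instance section variable its body does not use;
  this had left these constants quantified over *all* subgroups `K`, where they are false: for
  `G = Equiv.Perm ℕ`, `K` the stabiliser of `0` and `k = ℤ` there are two double cosets but
  `ℋ(G, K) ≅ ℤ`; binders restored, statements otherwise verbatim), all of them now discharged
  (`…_holds`, below and in `HeckeAlgebraProofs`, `HeckeAlgebraFixedPointsProofs`): the
  double-coset basis `exists_basis_heckeAlgebra` indexed by Mathlib's `HeckeCoset ⊤ K K`, the linear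
  identifications with `HeckeRing ⊤ K k` (as `HeckeCoset ⊤ K K →₀ k`, its definitional
  unfolding, since `HeckeRing` has no `Module` instance; plus an `AddEquiv` with `HeckeRing`
  itself) and with `biInvariantFunctions k G K`, and for `k = ℂ`, `K` compact open and a Haar
  measure `μ` the analytic description `heckeOperator ρ K g v = μ(K)⁻¹ ∫_{KgK} ρ(z) v dμ(z)`
  (`heckeOperator_apply_eq_integral`), i.e. the basis element of `KgK` is `π(𝟙_{KgK}) / μ(K)`.

## References

* C. Bushnell, G. Henniart, *The local Langlands conjecture for GL(2)*, Springer 2006, §4.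
* P. Cartier, *Representations of p-adic groups: a survey*, Proc. Sympos. Pure Math. 33 (1979),
  part 1, §I–IV.
* G. Shimura, *Introduction to the arithmetic theory of automorphic functions*, Chapter 3.
* B. Gross, *Some applications of Gelfand pairs to number theory*, Bull. Amer. Math. Soc. 24
  (1991), 277–302, §1 and Proposition 4.4.
* T. Ceccherini-Silberstein, F. Scarabotti, F. Tolli, *Discrete Harmonic Analysis*, CUP 2018,
  Definition 13.3.1.
* Mathlib, `Mathlib/NumberTheory/HeckeRing/Defs.lean`.
-/

open scoped Pointwise
open MonoidAlgebra

namespace Literature.NumberTheory.Automorphic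

section Algebra

variable (k G : Type*) [CommRing k] [Group G] (K : Subgroup G)

/-- The **Hecke algebra** `ℋ(G, K) = End_G(k[G ⧸ K])` of the pair `(G, K)` over `k`: the
commutant, inside `Module.End k k[G ⧸ K]`, of the permutation representation of `G` on the
free `k`-module on `G ⧸ K` (the compactly induced representation `c-Ind_K^G 𝟙`). By Frobenius
reciprocity this is the free `k`-module on the double cosets `K\G/K` that are finite unions of
left cosets (Bushnell–Henniart §4.1; Cartier 1979 §I.3–I.4). [cite: Cartier1979, §I.3–I.4] -/
noncomputable def heckeAlgebra : Subalgebra k (Module.End k (MonoidAlgebra k (G ⧸ K))) :=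
  Subalgebra.centralizer k (Set.range (Representation.ofMulAction k G (G ⧸ K)))

variable {k G K} in
/-- An endomorphism of `k[G ⧸ K]` lies in the Hecke algebra iff it commutes with the `G`-action
(Bushnell–Henniart §4.1). [folklore] -/
theorem mem_heckeAlgebra_iff (T : Module.End k (MonoidAlgebra k (G ⧸ K))) :
    T ∈ heckeAlgebra k G K ↔
      ∀ g : G, Representation.ofMulAction k G (G ⧸ K) g * T =
        T * Representation.ofMulAction k G (G ⧸ K) g := by
  simp [heckeAlgebra, Subalgebra.mem_centralizer_iff]

/-- `(G, K)` is a **Gelfand pair** over `k` if the Hecke algebra `ℋ(G, K) = End_G(k[G ⧸ K])` is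
commutative. This is a DEFINITION — a predicate on `(k, G, K)` — and not a named fact: its
universal closure is false (`not_isGelfandPair_bot` in `GelfandPair.lean`: for `K = ⊥`, `k`
nontrivial and `G` non-abelian the right translations lie in `ℋ(G, ⊥)` and do not commute), so
there is no `IsGelfandPair_holds`. The theorem content of the notion lives elsewhere in the tree:
the sufficient criteria (Gelfand's lemma / Gelfand's trick: `isGelfandPair_of_antiMulEquiv`,
`isGelfandPair_of_inv_mem_doubleCoset`, `IsGelfandPair.of_perm`, `isGelfandPair_of_commGroup`,
`isGelfandPair_top`) in `GelfandPair.lean`, and the motivating instance `(GLₙ(F), GLₙ(𝒪_F))` for a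
non-archimedean local field `F` (via the Satake isomorphism / Cartan decomposition; Cartier 1979,
§IV) as `SatakeParametersGL.isGelfandPair_glInt` with its discharge
`SatakeParametersGL.isGelfandPair_glInt_holds`.
Sources for the definition: Gross 1991 (*Some applications of Gelfand pairs to number theory*,
Bull. AMS 24), condition (1.4) and Proposition 4.4 ("if `H` is compact and open in `G`, then `H`
is a Gelfand subgroup iff the Hecke algebra `L(H\G/H)` is commutative under convolution");
Ceccherini-Silberstein–Scarabotti–Tolli 2018, Definition 13.3.1 (`(G, K)` is a Gelfand pair iff
`ℋ(G, K, ι_K) ≅ L(K\G/K)` is commutative); Bump 1997, Exercise 2.4.3.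
The parameters `(k G K)` are explicit binders since the 2026-08-15 verdict clean-up (same
elaborated statement `IsGelfandPair k G K`, all users unchanged); before that the predicate
carried a citation fact-tag and was counted as an undischargeable named fact. [folklore] -/
def IsGelfandPair (k G : Type*) [CommRing k] [Group G] (K : Subgroup G) : Prop :=
  ∀ a b : heckeAlgebra k G K, a * b = b * a

/-- The `k`-submodule of **bi-`K`-invariant functions** `f : G → k` supported on finitely many
double cosets `KgK`: `f (x * g * y) = f g` for `x, y ∈ K`, and the set of double cosets meeting
the support of `f` is finite. For `G` locally profinite and `K` compact open this is
`C_c(K\G/K; k)` (Bushnell–Henniart §4.1; Cartier 1979 §I.3). [cite: Cartier1979, §I.3] -/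
def biInvariantFunctions : Submodule k (G → k) where
  carrier := {f | (∀ x ∈ K, ∀ y ∈ K, ∀ g : G, f (x * g * y) = f g) ∧
    (DoubleCoset.mk K K '' Function.support f).Finite}
  zero_mem' := ⟨fun _ _ _ _ _ => rfl, by simp⟩
  add_mem' := by
    rintro f₁ f₂ ⟨h₁, h₁'⟩ ⟨h₂, h₂'⟩
    refine ⟨fun x hx y hy g => by simp [h₁ x hx y hy g, h₂ x hx y hy g], ?_⟩
    refine ((h₁'.union h₂').subset ?_)
    rw [← Set.image_union]
    exact Set.image_mono (Function.support_add f₁ f₂)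
  smul_mem' := by
    rintro c f ⟨h, h'⟩
    refine ⟨fun x hx y hy g => by simp [h x hx y hy g], h'.subset ?_⟩
    exact Set.image_mono (Function.support_const_smul_subset c f)

variable {k G K} in
/-- Membership in `biInvariantFunctions`. [folklore] -/
theorem mem_biInvariantFunctions_iff (f : G → k) :
    f ∈ biInvariantFunctions k G K ↔
      (∀ x ∈ K, ∀ y ∈ K, ∀ g : G, f (x * g * y) = f g) ∧
        (DoubleCoset.mk K K '' Function.support f).Finite :=
  Iff.rfl

end Algebra

/-! ### Concrete Hecke operators on a representation -/

section Operator

variable {k G V : Type*} [CommRing k] [Group G] [AddCommGroup V] [Module k V]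
  (ρ : Representation k G V) (K : Subgroup G)

/-- The **Hecke operator** `[KgK]` of the double coset `KgK` acting on a representation `ρ`:
`heckeOperator ρ K g = ∑_{yK ⊆ KgK} ρ(y)`, the sum running over the (`K`-orbit of `gK` in)
`G ⧸ K` with representatives chosen by `Quotient.out`. On `K`-fixed vectors `v ∈ V^K` this is
independent of the representatives and lands in `V^K` (`heckeOperator_apply_eq_sum`,
`heckeOperator_apply_mem_fixedPoints`); for `k = ℂ` and `K` compact open it is
`π(𝟙_{KgK}) / μ(K)` (`heckeOperator_apply_eq_integral`). Junk values (documented, D9 of the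
outline): off `V^K` the value depends on the choice of representatives, and if `KgK/K` is
infinite the `finsum` is `0` (Bushnell–Henniart §4.1–4.2; Cartier 1979 §IV). [cite: Cartier1979, §IV] -/
noncomputable def heckeOperator (g : G) : Module.End k V :=
  ∑ᶠ y ∈ MulAction.orbit K (g : G ⧸ K), ρ y.out

/-- On a `K`-fixed vector the Hecke operator `[KgK]` is `∑_{x ∈ s} ρ(x) v` for *any* transversal
`s` of `KgK/K` (Bushnell–Henniart §4.1). [folklore] -/
theorem heckeOperator_apply_eq_sum (g : G) (s : Finset G)
    (hs : Set.BijOn (fun x : G => (x : G ⧸ K)) s (MulAction.orbit K (g : G ⧸ K)))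
    {v : V} (hv : v ∈ ρ.fixedPoints K) :
    heckeOperator ρ K g v = ∑ x ∈ s, ρ x v := by
  classical
  have himg : MulAction.orbit K (g : G ⧸ K) =
      ((s.image fun x : G => (x : G ⧸ K)) : Set (G ⧸ K)) := by
    rw [Finset.coe_image, hs.image_eq]
  rw [heckeOperator, himg, finsum_mem_coe_finset, LinearMap.sum_apply,
    Finset.sum_image (fun x hx y hy h => hs.injOn hx hy h)]
  refine Finset.sum_congr rfl fun x _ => ?_
  obtain ⟨h, H⟩ := QuotientGroup.mk_out_eq_mul K x
  rw [H, map_mul, Module.End.mul_apply, (ρ.mem_fixedPoints K v).1 hv _ h.2]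

/-- The Hecke operator `[KgK]` preserves the `K`-fixed vectors when `KgK/K` is finite
(Bushnell–Henniart §4.1). [folklore] -/
theorem heckeOperator_apply_mem_fixedPoints (g : G) {v : V} (hv : v ∈ ρ.fixedPoints K)
    (hfin : (MulAction.orbit K (g : G ⧸ K)).Finite) :
    heckeOperator ρ K g v ∈ ρ.fixedPoints K := by
  classical
  rw [ρ.mem_fixedPoints]
  intro x hx
  rw [heckeOperator, finsum_mem_eq_finite_toFinset_sum _ hfin, LinearMap.sum_apply, map_sum]
  -- reindex the sum along the permutation `y ↦ x • y` of the orbit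
  refine Finset.sum_nbij (fun y => (⟨x, hx⟩ : K) • y) (fun y hy => ?_) (fun y _ z _ h => ?_)
    (fun z hz => ?_) (fun y _ => ?_)
  · rw [Set.Finite.mem_toFinset] at hy ⊢
    exact MulAction.mem_orbit_of_mem_orbit _ hy
  · exact smul_left_cancel _ h
  · rw [Finset.mem_coe, Set.Finite.mem_toFinset] at hz
    refine ⟨(⟨x, hx⟩ : K)⁻¹ • z, ?_, smul_inv_smul _ _⟩
    rw [Finset.mem_coe, Set.Finite.mem_toFinset]
    exact MulAction.mem_orbit_of_mem_orbit _ hz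
  · -- `ρ x (ρ y.out v) = ρ (x • y).out v` as both representatives lie in the coset `x • y`
    obtain ⟨h', H'⟩ := QuotientGroup.mk_out_eq_mul K (x * y.out)
    have hxy : ((⟨x, hx⟩ : K) • y) = ((x * y.out : G) : G ⧸ K) := by
      conv_lhs => rw [← QuotientGroup.out_eq' y]
      rfl
    rw [hxy, H', map_mul, map_mul, Module.End.mul_apply, Module.End.mul_apply,
      (ρ.mem_fixedPoints K v).1 hv _ h'.2]

/-- The Hecke operator of the trivial double coset `K1K = K` is the identity on `V^K`
(Bushnell–Henniart §4.1). [folklore] -/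
theorem heckeOperator_one_apply {v : V} (hv : v ∈ ρ.fixedPoints K) :
    heckeOperator ρ K 1 v = v := by
  have horb : MulAction.orbit K ((1 : G) : G ⧸ K) = {((1 : G) : G ⧸ K)} := by
    ext y
    simp only [MulAction.mem_orbit_iff, Set.mem_singleton_iff]
    constructor
    · rintro ⟨x, rfl⟩
      change (((x : G) * 1 : G) : G ⧸ K) = _
      rw [QuotientGroup.eq]
      simp
    · rintro rfl
      exact ⟨1, one_smul _ _⟩
  rw [heckeOperator, horb, finsum_mem_singleton]
  obtain ⟨h, H⟩ := QuotientGroup.mk_out_eq_mul K (1 : G)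
  rw [H, one_mul]
  exact (ρ.mem_fixedPoints K v).1 hv _ h.2

end Operator

/-! ### The Hecke-pair (finiteness) condition -/

section HeckePair

variable {G : Type*} [Group G] (K : Subgroup G)

/-- If every conjugate of `K` is commensurable with `K` (i.e. the commensurator of `K` is all of
`G`), then `(K, G, K)` is a Hecke pair in Mathlib's sense (Shimura, Chapter 3;
`IsHeckeTriple.of_diagonal`). [folklore] -/
theorem isHeckeTriple_top_of_commensurator_eq_top
    (h : Subgroup.Commensurable.commensurator K = ⊤) :
    IsHeckeTriple (⊤ : Submonoid G) K K :=
  IsHeckeTriple.of_diagonal le_top (by simp [h])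

/-- Conversely, a Hecke pair `(K, G, K)` has commensurator all of `G`. [folklore] -/
theorem commensurator_eq_top [IsHeckeTriple (⊤ : Submonoid G) K K] :
    Subgroup.Commensurable.commensurator K = ⊤ := by
  rw [eq_top_iff]
  intro g _
  exact IsHeckeTriple.mem_commensurator_right (Δ := ⊤) K ⟨g, Submonoid.mem_top g⟩

/-- An open subgroup `A` has finite index relative to a compact subgroup `B` of a topological
group: `B ⧸ (A ⊓ B)` is compact and discrete (Bushnell–Henniart §1.1). [folklore] -/
theorem relIndex_ne_zero_of_isOpen_of_isCompact [TopologicalSpace G] [IsTopologicalGroup G]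
    {A B : Subgroup G} (hA : IsOpen (A : Set G)) (hB : IsCompact (B : Set G)) :
    A.relIndex B ≠ 0 := by
  haveI : CompactSpace B := isCompact_iff_compactSpace.mp hB
  have hopen : IsOpen ((A.subgroupOf B : Subgroup B) : Set B) :=
    hA.preimage continuous_subtype_val
  haveI : Finite (B ⧸ A.subgroupOf B) := Subgroup.quotient_finite_of_isOpen _ hopen
  exact (Subgroup.finiteIndex_of_finite_quotient (H := A.subgroupOf B)).index_ne_zero

/-- A compact open subgroup `K` of a topological group is a Hecke pair with `G`: `K ∩ gKg⁻¹` is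
open in the compact groups `K` and `gKg⁻¹`, hence of finite index in both
(Bushnell–Henniart §4.1; Cartier 1979 §I.3). [cite: Cartier1979, §I.3] -/
theorem isHeckeTriple_top_of_isCompact_isOpen [TopologicalSpace G] [IsTopologicalGroup G]
    (hK : IsCompact (K : Set G)) (hK' : IsOpen (K : Set G)) :
    IsHeckeTriple (⊤ : Submonoid G) K K := by
  refine isHeckeTriple_top_of_commensurator_eq_top K (eq_top_iff.2 fun g _ => ?_)
  rw [Subgroup.Commensurable.commensurator_mem_iff]
  set L : Subgroup G := ConjAct.toConjAct g • K
  have hL : (L : Set G) =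
      ((Homeomorph.mulLeft g).trans (Homeomorph.mulRight g⁻¹)) '' (K : Set G) := by
    ext x
    simp only [L, Subgroup.coe_pointwise_smul, Set.mem_smul_set, Set.mem_image,
      ConjAct.smul_def, ConjAct.ofConjAct_toConjAct, Homeomorph.trans_apply,
      Homeomorph.coe_mulLeft, Homeomorph.coe_mulRight, SetLike.mem_coe]
  have hLo : IsOpen (L : Set G) := hL ▸ (Homeomorph.isOpen_image _).2 hK'
  have hLc : IsCompact (L : Set G) := hL ▸ hK.image (Homeomorph.continuous _)
  exact ⟨relIndex_ne_zero_of_isOpen_of_isCompact hLo hK,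
    relIndex_ne_zero_of_isOpen_of_isCompact hK' hLc⟩

/-- For a Hecke pair, every double coset `KgK` is a finite union of left cosets: the `K`-orbit
of `gK` in `G ⧸ K` is finite (it is in bijection with `K ⧸ (K ∩ gKg⁻¹)`; Shimura,
Proposition 3.1). [folklore] -/
theorem finite_orbit_quotient [IsHeckeTriple (⊤ : Submonoid G) K K] (g : G) :
    (MulAction.orbit K (g : G ⧸ K)).Finite := by
  have hc : Subgroup.Commensurable (ConjAct.toConjAct g • K) K :=
    IsHeckeTriple.mem_commensurator_right (Δ := ⊤) K ⟨g, Submonoid.mem_top g⟩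
  have hle : (ConjAct.toConjAct g • K).subgroupOf K ≤ MulAction.stabilizer K (g : G ⧸ K) := by
    intro x hx
    rw [Subgroup.mem_subgroupOf, Subgroup.mem_pointwise_smul_iff_inv_smul_mem,
      ConjAct.smul_def] at hx
    rw [MulAction.mem_stabilizer_iff]
    change (((x : G) * g : G) : G ⧸ K) = _
    rw [QuotientGroup.eq]
    have := K.inv_mem hx
    simpa [mul_assoc] using this
  haveI : ((ConjAct.toConjAct g • K).subgroupOf K).FiniteIndex := ⟨hc.1⟩
  haveI : (MulAction.stabilizer K (g : G ⧸ K)).FiniteIndex := Subgroup.finiteIndex_of_le hle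
  exact Set.finite_coe_iff.mp
    (Finite.of_equiv _ (MulAction.orbitEquivQuotientStabilizer K (g : G ⧸ K)).symm)

end HeckePair

/-! ### Structure of the Hecke algebra of a Hecke pair -/

section Structure

variable (k G : Type*) [CommRing k] [Group G] (K : Subgroup G)

/-- The **characteristic element** of the double coset `KgK` in `k[G ⧸ K]`:
`𝟙_{KgK} = ∑_{yK ⊆ KgK} [yK]`, a finite sum for a Hecke pair (`finite_orbit_quotient`; junk `0`
otherwise). This is the image of the basis vector `[K] = [1·K]` under the Hecke-algebra element
attached to `KgK` (Bushnell–Henniart §4.1; Shimura §3.1). [folklore] -/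
noncomputable def doubleCosetIndicator (g : G) : MonoidAlgebra k (G ⧸ K) :=
  ∑ᶠ y ∈ MulAction.orbit K (g : G ⧸ K), MonoidAlgebra.single y (1 : k)

/-- **Double-coset basis** of the Hecke algebra of a Hecke pair: `ℋ(G, K) = End_G(k[G ⧸ K])`
is `k`-free on the double cosets `K\G/K` (Mathlib's `HeckeCoset ⊤ K K`), the basis element of
`KgK` being the unique `G`-endomorphism sending `[K]` to `𝟙_{KgK} = ∑_{yK ⊆ KgK} [yK]`
(Frobenius reciprocity `End_G(c-Ind 𝟙) = (k[G ⧸ K])^K`; Bushnell–Henniart §4.1;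
Shimura, Proposition 3.1; Cartier 1979 §I.4).
The Hecke-pair hypothesis is the explicit binder `[IsHeckeTriple ⊤ K K]` of this fact (see the
module docstring). [cite: Cartier1979, §I.4] -/
def exists_basis_heckeAlgebra [IsHeckeTriple (⊤ : Submonoid G) K K] : Prop :=
  ∃ b : Module.Basis (HeckeCoset (⊤ : Submonoid G) K K) k (heckeAlgebra k G K),
      ∀ g : G, (b (HeckeCoset.mk K K ⟨g, Submonoid.mem_top g⟩) :
          Module.End k (MonoidAlgebra k (G ⧸ K))) (MonoidAlgebra.single ((1 : G) : G ⧸ K) 1) =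
        doubleCosetIndicator k G K g

/-- The Hecke algebra of a Hecke pair is `k`-linearly isomorphic to (the underlying module
`HeckeCoset ⊤ K K →₀ k` of) Mathlib's Hecke ring `HeckeRing ⊤ K k`. In this Mathlib snapshot
`HeckeRing` is definitionally this `Finsupp` type (`HeckeCosetModule.of`) but carries no
`Module k` instance, so the `k`-linear statement is made with the `Finsupp` model; see
`nonempty_addEquiv_heckeRing` for `HeckeRing` itself (Shimura §3.1;
`Mathlib/NumberTheory/HeckeRing/Defs.lean`).
The Hecke-pair hypothesis is the explicit binder `[IsHeckeTriple ⊤ K K]` of this fact (see the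
module docstring). [folklore] -/
def nonempty_linearEquiv_heckeRing [IsHeckeTriple (⊤ : Submonoid G) K K] : Prop :=
  Nonempty (heckeAlgebra k G K ≃ₗ[k] (HeckeCoset (⊤ : Submonoid G) K K →₀ k))

/- interim proof relied on results that are now named facts (D-0014); demoted to a fact by the M5 import, proof preserved:
:= by
  obtain ⟨b, -⟩ := exists_basis_heckeAlgebra k G K
  exact ⟨b.repr⟩
-/

/-- The Hecke algebra of a Hecke pair is additively isomorphic to Mathlib's `HeckeRing ⊤ K k`
(which has no `Module`/`Ring` structure in this Mathlib snapshot; Shimura §3.1).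
The Hecke-pair hypothesis is the explicit binder `[IsHeckeTriple ⊤ K K]` of this fact (see the
module docstring). [folklore] -/
def nonempty_addEquiv_heckeRing [IsHeckeTriple (⊤ : Submonoid G) K K] : Prop :=
  Nonempty (heckeAlgebra k G K ≃+ HeckeRing (⊤ : Submonoid G) K k)

/- interim proof relied on results that are now named facts (D-0014); demoted to a fact by the M5 import, proof preserved:
:= by
  obtain ⟨b, -⟩ := exists_basis_heckeAlgebra k G K
  exact ⟨b.repr.toAddEquiv.trans (AddEquiv.mk' HeckeCosetModule.of fun _ _ => rfl)⟩
-/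

/-- The Hecke algebra of a Hecke pair is `k`-linearly isomorphic to the bi-`K`-invariant
functions supported on finitely many double cosets, `T ↦ (g ↦ coefficient of [gK] in T [K])`
(Bushnell–Henniart §4.1; Cartier 1979 §I.3).
The Hecke-pair hypothesis is the explicit binder `[IsHeckeTriple ⊤ K K]` of this fact (see the
module docstring). [cite: Cartier1979, §I.3] -/
def nonempty_linearEquiv_biInvariant [IsHeckeTriple (⊤ : Submonoid G) K K] : Prop :=
  Nonempty (heckeAlgebra k G K ≃ₗ[k] biInvariantFunctions k G K)

/-- **Action on `K`-fixed vectors.** For a Hecke pair and any representation `ρ` of `G`, the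
identification `V^K = Hom_G(k[G ⧸ K], V)` (Frobenius reciprocity) makes `V^K` a right module
over `ℋ(G, K) = End_G(k[G ⧸ K])`, i.e. gives a `k`-algebra map out of the opposite algebra, and
the basis element of `KgK` acts by the concrete Hecke operator `heckeOperator ρ K g`
(Bushnell–Henniart §4.2, Proposition; Cartier 1979 §IV.1). The `ᵐᵒᵖ` records that
`End_G(c-Ind 𝟙)` is anti-isomorphic to the convolution algebra acting on the left.
The Hecke-pair hypothesis is the explicit binder `[IsHeckeTriple ⊤ K K]` of this fact (see the
module docstring). [cite: Cartier1979, §IV.1] -/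
def exists_algHom_moduleEnd_fixedPoints [IsHeckeTriple (⊤ : Submonoid G) K K]
    {V : Type*} [AddCommGroup V] [Module k V] : Prop :=
  ∀ (ρ : Representation k G V),
    ∃ a : (heckeAlgebra k G K)ᵐᵒᵖ →ₐ[k] Module.End k (ρ.fixedPoints K),
      ∀ (T : heckeAlgebra k G K) (g : G),
        (T : Module.End k (MonoidAlgebra k (G ⧸ K))) (MonoidAlgebra.single ((1 : G) : G ⧸ K) 1) =
            doubleCosetIndicator k G K g →
          ∀ v : ρ.fixedPoints K, (a (MulOpposite.op T) v : V) = heckeOperator ρ K g v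

end Structure

/-! ### Analytic description over `ℂ` -/

section Haar

open MeasureTheory

variable {G : Type*} [Group G] [TopologicalSpace G] [IsTopologicalGroup G] [MeasurableSpace G]
  [BorelSpace G] (μ : Measure G) [μ.IsHaarMeasure] (K : Subgroup G)
  {V : Type*} [NormedAddCommGroup V] [NormedSpace ℂ V] [CompleteSpace V]

/-- **Haar/convolution description.** For `K` compact open in a topological group with left
Haar measure `μ` and `v ∈ V^K`, the Hecke operator of `KgK` is
`[KgK] v = μ(K)⁻¹ ∫_{KgK} ρ(z) v dμ(z) = π(𝟙_{KgK} / μ(K)) v`; i.e. under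
`ℋ(G, K) ≅ C_c(K\G/K)` with convolution normalised by `μ(K) = 1`, the basis element of `KgK`
is the characteristic function `𝟙_{KgK}` (Bushnell–Henniart §4.1–4.2; Cartier 1979 §IV.1).
The integrand `z ↦ ρ(z) v` is locally constant (constant on cosets `zK`), so no continuity
hypothesis on `ρ` is needed. [cite: Cartier1979, §IV.1] -/
def heckeOperator_apply_eq_integral : Prop :=
  ∀ (hK : IsCompact (K : Set G)) (hK' : IsOpen (K : Set G)) (ρ : Representation ℂ G V) (g : G) {v : V} (hv : v ∈ ρ.fixedPoints K),
    heckeOperator ρ K g v =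
      (μ K).toReal⁻¹ • ∫ z in DoubleCoset.doubleCoset g K K, ρ z v ∂μ

end Haar

end Literature.NumberTheory.Automorphic

/-! ### Frobenius reciprocity: the double-coset basis of `ℋ(G, K)` (discharges)

`End_G(k[G ⧸ K]) ≅ (k[G ⧸ K])^K`, `T ↦ T [K]` (Frobenius reciprocity / Mackey's description of
intertwiners of an induced representation: Bump 1997, Proposition 4.1.2 and Exercise 4.5.5;
Ceccherini-Silberstein–Scarabotti–Tolli 2020, §1.3, (1.11): `ᴷL(G)ᴷ ≅ End_G(L(G)ᴷ)`), and
`(k[G ⧸ K])^K` is `k`-free on the `K`-orbits of `G ⧸ K`, i.e. on the double cosets `K\G/K`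
(Shimura 1971, §3.1: `R(Γ, Δ)` is the free module on the `ΓαΓ`), all of which are finite for a
Hecke pair (`finite_orbit_quotient`). Below this is carried out sorry-free, discharging
`nonempty_linearEquiv_heckeRing`, `nonempty_addEquiv_heckeRing` and `exists_basis_heckeAlgebra`. -/

namespace Literature.NumberTheory.Automorphic

namespace heckeAlgebra

section DoubleCosets

variable {G : Type*} [Group G] (K : Subgroup G)

/-- The double coset `KgK ∈ K\G/K` (Mathlib's `HeckeCoset ⊤ K K`) of a left coset
`gK ∈ G ⧸ K`, computed on the representative `Quotient.out (gK)`; see `toHeckeCoset_coe`.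
[folklore] -/
noncomputable def toHeckeCoset (x : G ⧸ K) : HeckeCoset (⊤ : Submonoid G) K K :=
  HeckeCoset.mk K K ⟨x.out, Submonoid.mem_top _⟩

/-- Two elements of `G` have the same Hecke double coset iff `g' ∈ KgK`. [folklore] -/
theorem heckeCosetMk_eq_iff {g g' : G} (hg : g ∈ (⊤ : Submonoid G))
    (hg' : g' ∈ (⊤ : Submonoid G)) :
    HeckeCoset.mk K K ⟨g, hg⟩ = HeckeCoset.mk K K ⟨g', hg'⟩ ↔
      ∃ a ∈ K, ∃ b ∈ K, g' = a * g * b :=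
  (Quotient.eq (r := HeckeCoset.setoid ⊤ K K)).trans DoubleCoset.rel_iff

/-- `g'K` lies in the `K`-orbit of `gK` in `G ⧸ K` iff `g' ∈ KgK`. [folklore] -/
theorem coe_mem_orbit_coe_iff (g g' : G) :
    (g' : G ⧸ K) ∈ MulAction.orbit K (g : G ⧸ K) ↔
      ∃ a ∈ K, ∃ b ∈ K, g' = a * g * b := by
  rw [MulAction.mem_orbit_iff]
  constructor
  · rintro ⟨a, ha⟩
    change (((a : G) * g : G) : G ⧸ K) = _ at ha
    rw [QuotientGroup.eq] at ha
    exact ⟨a, a.2, _, ha, (mul_inv_cancel_left _ _).symm⟩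
  · rintro ⟨a, ha, b, hb, rfl⟩
    refine ⟨⟨a, ha⟩, ?_⟩
    change (((a : G) * g : G) : G ⧸ K) = _
    rw [QuotientGroup.eq]
    rwa [inv_mul_cancel_left]

/-- `toHeckeCoset` on a coset `gK` is the double coset of `g`. [folklore] -/
theorem toHeckeCoset_coe (g : G) :
    toHeckeCoset K (g : G ⧸ K) = HeckeCoset.mk K K ⟨g, Submonoid.mem_top g⟩ := by
  rw [toHeckeCoset, heckeCosetMk_eq_iff]
  obtain ⟨h, H⟩ := QuotientGroup.mk_out_eq_mul K g
  exact ⟨1, K.one_mem, (h : G)⁻¹, K.inv_mem h.2, by rw [H, one_mul, mul_inv_cancel_right]⟩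

/-- Two left cosets have the same double coset iff they lie in one `K`-orbit of `G ⧸ K`:
`K\(G/K) = K\G/K`. [folklore] -/
theorem toHeckeCoset_eq_iff (x y : G ⧸ K) :
    toHeckeCoset K x = toHeckeCoset K y ↔ y ∈ MulAction.orbit K x := by
  rw [toHeckeCoset, toHeckeCoset, heckeCosetMk_eq_iff, ← coe_mem_orbit_coe_iff,
    QuotientGroup.out_eq', QuotientGroup.out_eq']

/-- `toHeckeCoset` is `K`-invariant. [folklore] -/
theorem toHeckeCoset_smul (a : K) (x : G ⧸ K) : toHeckeCoset K (a • x) = toHeckeCoset K x :=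
  (toHeckeCoset_eq_iff K _ _).2 (MulAction.mem_orbit_iff.2 ⟨a⁻¹, inv_smul_smul a x⟩)

/-- A left coset inside a given double coset (a section of `toHeckeCoset`). [folklore] -/
noncomputable def ofHeckeCoset (D : HeckeCoset (⊤ : Submonoid G) K K) : G ⧸ K :=
  (((Quotient.out D : (⊤ : Submonoid G)) : G) : G ⧸ K)

/-- `ofHeckeCoset` is a section of `toHeckeCoset`. [folklore] -/
theorem toHeckeCoset_ofHeckeCoset (D : HeckeCoset (⊤ : Submonoid G) K K) :
    toHeckeCoset K (ofHeckeCoset K D) = D := by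
  rw [ofHeckeCoset, toHeckeCoset_coe]
  exact Quotient.out_eq D

/-- `ofHeckeCoset` is injective (it has the left inverse `toHeckeCoset`). [folklore] -/
theorem ofHeckeCoset_injective : Function.Injective (ofHeckeCoset K) :=
  Function.LeftInverse.injective (g := toHeckeCoset K) (toHeckeCoset_ofHeckeCoset K)

/-- The chosen left coset of the double coset of `xK` lies in the `K`-orbit of `xK`. [folklore] -/
theorem ofHeckeCoset_toHeckeCoset_mem_orbit (x : G ⧸ K) :
    ofHeckeCoset K (toHeckeCoset K x) ∈ MulAction.orbit K x := by
  rw [← toHeckeCoset_eq_iff, toHeckeCoset_ofHeckeCoset]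

/-- For a Hecke pair every double coset contains only finitely many left cosets
(Shimura, Proposition 3.1). [folklore] -/
theorem finite_preimage_toHeckeCoset [IsHeckeTriple (⊤ : Submonoid G) K K]
    (D : HeckeCoset (⊤ : Submonoid G) K K) : (toHeckeCoset K ⁻¹' {D}).Finite := by
  have h : toHeckeCoset K ⁻¹' {D} = MulAction.orbit K (ofHeckeCoset K D) := by
    ext y
    rw [Set.mem_preimage, Set.mem_singleton_iff, ← toHeckeCoset_eq_iff, toHeckeCoset_ofHeckeCoset,
      eq_comm]
  rw [h, ofHeckeCoset]
  exact finite_orbit_quotient K _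

end DoubleCosets

section Reciprocity

open Representation

variable {k G : Type*} [CommRing k] [Group G] (K : Subgroup G)

/-- Elements of `ℋ(G, K) = End_G(k[G ⧸ K])` commute with the `G`-action (pointwise form of
`mem_heckeAlgebra_iff`). [folklore] -/
theorem apply_ofMulAction_apply (T : heckeAlgebra k G K) (g : G) (f : MonoidAlgebra k (G ⧸ K)) :
    (T : Module.End k (MonoidAlgebra k (G ⧸ K))) (ofMulAction k G (G ⧸ K) g f) =
      ofMulAction k G (G ⧸ K) g ((T : Module.End k (MonoidAlgebra k (G ⧸ K))) f) := by
  have h := LinearMap.congr_fun ((mem_heckeAlgebra_iff _).1 T.2 g) f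
  simpa only [Module.End.mul_apply] using h.symm

/-- `K` fixes the trivial coset `[K] ∈ G ⧸ K`. [folklore] -/
theorem smul_coe_one {a : G} (ha : a ∈ K) : a • ((1 : G) : G ⧸ K) = ((1 : G) : G ⧸ K) := by
  change (((a * 1 : G)) : G ⧸ K) = _
  rw [QuotientGroup.eq]
  simpa using K.inv_mem ha

/-- `[xK] = ρ(x̃) [K]` for the chosen representative `x̃` of `xK`: `k[G ⧸ K]` is generated by
`[K]` as a `G`-module. [folklore] -/
theorem single_eq_ofMulAction_out (x : G ⧸ K) :
    MonoidAlgebra.single x (1 : k) =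
      ofMulAction k G (G ⧸ K) x.out (MonoidAlgebra.single ((1 : G) : G ⧸ K) 1) := by
  rw [ofMulAction_single]
  congr 1
  change x = (((x.out : G) * 1 : G) : G ⧸ K)
  rw [mul_one, QuotientGroup.out_eq']

/-- The image `T [K]` of the basis vector of the trivial coset is `K`-invariant. [folklore] -/
theorem ofMulAction_apply_single_one (T : heckeAlgebra k G K) (a : G) (ha : a ∈ K) :
    ofMulAction k G (G ⧸ K) a ((T : Module.End k (MonoidAlgebra k (G ⧸ K)))
        (MonoidAlgebra.single ((1 : G) : G ⧸ K) 1)) =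
      (T : Module.End k (MonoidAlgebra k (G ⧸ K)))
        (MonoidAlgebra.single ((1 : G) : G ⧸ K) 1) := by
  rw [← apply_ofMulAction_apply, ofMulAction_single, smul_coe_one K ha]

/-- Coefficients of a `K`-invariant element of `k[G ⧸ K]` are constant along `K`-orbits.
[folklore] -/
theorem coeff_eq_of_mem_orbit {v : MonoidAlgebra k (G ⧸ K)}
    (hv : ∀ a ∈ K, ofMulAction k G (G ⧸ K) a v = v) {x y : G ⧸ K}
    (h : y ∈ MulAction.orbit K x) : v.coeff y = v.coeff x := by
  obtain ⟨a, rfl⟩ := MulAction.mem_orbit_iff.1 h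
  conv_lhs => rw [← hv _ a.2]
  rw [coeff_ofMulAction]
  change v.coeff ((a : G)⁻¹ • (a : G) • x) = v.coeff x
  rw [inv_smul_smul]

/-- If `v ∈ k[G ⧸ K]` is `K`-invariant then `ρ(x̃) v` only depends on the coset `xK` of the
representative: `ρ((g • x)~) v = ρ(g) ρ(x̃) v`. [folklore] -/
theorem ofMulAction_out_smul {v : MonoidAlgebra k (G ⧸ K)}
    (hv : ∀ a ∈ K, ofMulAction k G (G ⧸ K) a v = v) (g : G) (x : G ⧸ K) :
    ofMulAction k G (G ⧸ K) (g • x).out v =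
      ofMulAction k G (G ⧸ K) g (ofMulAction k G (G ⧸ K) x.out v) := by
  obtain ⟨h, H⟩ := QuotientGroup.mk_out_eq_mul K (g * x.out)
  have hgx : g • x = ((g * x.out : G) : G ⧸ K) := by
    conv_lhs => rw [← QuotientGroup.out_eq' x]
    rfl
  rw [hgx, H, map_mul, map_mul, Module.End.mul_apply, Module.End.mul_apply, hv _ h.2]

/-- The `k`-linear endomorphism of `k[G ⧸ K]` with `[xK] ↦ ρ(x̃) v`, `x̃ = Quotient.out (xK)`;
for `K`-invariant `v` it is the unique `G`-endomorphism with `[K] ↦ v` (Frobenius reciprocity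
`End_G(c-Ind_K^G 𝟙) = (c-Ind_K^G 𝟙)^K`; Bump 1997, Proposition 4.1.2). [folklore] -/
noncomputable def extend (v : MonoidAlgebra k (G ⧸ K)) :
    Module.End k (MonoidAlgebra k (G ⧸ K)) :=
  Finsupp.linearCombination k (fun x : G ⧸ K => ofMulAction k G (G ⧸ K) x.out v) ∘ₗ
    (MonoidAlgebra.coeffLinearEquiv k).toLinearMap

/-- `extend K v [xK] = ρ(x̃) v` on basis vectors. [folklore] -/
theorem extend_single (v : MonoidAlgebra k (G ⧸ K)) (x : G ⧸ K) (r : k) :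
    extend K v (MonoidAlgebra.single x r) = r • ofMulAction k G (G ⧸ K) x.out v := by
  simp [extend, Finsupp.linearCombination_single]

/-- For `K`-invariant `v`, `extend K v` is `G`-equivariant, i.e. lies in `ℋ(G, K)`. [folklore] -/
theorem extend_mem {v : MonoidAlgebra k (G ⧸ K)}
    (hv : ∀ a ∈ K, ofMulAction k G (G ⧸ K) a v = v) : extend K v ∈ heckeAlgebra k G K := by
  rw [mem_heckeAlgebra_iff]
  intro g
  refine MonoidAlgebra.lhom_ext' fun x => LinearMap.ext_ring ?_
  simp only [LinearMap.comp_apply, MonoidAlgebra.lsingle_apply, Module.End.mul_apply,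
    ofMulAction_single, extend_single, one_smul, ofMulAction_out_smul K hv]

/-- **Frobenius reciprocity coordinates.** `T ↦ (KgK ↦ coefficient of T [K] at a left coset in
`KgK`)`, a `k`-linear map `ℋ(G, K) → (K\G/K →₀ k)`. [folklore] -/
noncomputable def doubleCosetCoeff :
    heckeAlgebra k G K →ₗ[k] (HeckeCoset (⊤ : Submonoid G) K K →₀ k) where
  toFun T := Finsupp.comapDomain (ofHeckeCoset K)
    ((T : Module.End k (MonoidAlgebra k (G ⧸ K)))
      (MonoidAlgebra.single ((1 : G) : G ⧸ K) 1)).coeff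
    (ofHeckeCoset_injective K).injOn
  map_add' _ _ := Finsupp.ext fun _ => rfl
  map_smul' _ _ := Finsupp.ext fun _ => rfl

/-- Unfolding of `doubleCosetCoeff`. [folklore] -/
theorem doubleCosetCoeff_apply (T : heckeAlgebra k G K) (D : HeckeCoset (⊤ : Submonoid G) K K) :
    doubleCosetCoeff K T D = ((T : Module.End k (MonoidAlgebra k (G ⧸ K)))
      (MonoidAlgebra.single ((1 : G) : G ⧸ K) 1)).coeff (ofHeckeCoset K D) :=
  rfl

/-- `T ↦ T [K]` is injective on `End_G(k[G ⧸ K])`, and `T [K]` is determined by its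
coefficients on a transversal of the `K`-orbits. [folklore] -/
theorem doubleCosetCoeff_injective : Function.Injective (doubleCosetCoeff (k := k) K) := by
  rw [injective_iff_map_eq_zero]
  intro T hT
  have hw : (T : Module.End k (MonoidAlgebra k (G ⧸ K)))
      (MonoidAlgebra.single ((1 : G) : G ⧸ K) 1) = 0 := by
    refine MonoidAlgebra.ext (Finsupp.ext fun y => ?_)
    rw [← coeff_eq_of_mem_orbit K (ofMulAction_apply_single_one K T)
      (ofHeckeCoset_toHeckeCoset_mem_orbit K y), ← doubleCosetCoeff_apply, hT]
    simp
  refine Subtype.ext (MonoidAlgebra.lhom_ext' fun x => LinearMap.ext_ring ?_)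
  simp only [LinearMap.comp_apply, MonoidAlgebra.lsingle_apply, ZeroMemClass.coe_zero,
    LinearMap.zero_apply]
  rw [single_eq_ofMulAction_out K x, apply_ofMulAction_apply, hw, map_zero]

variable [IsHeckeTriple (⊤ : Submonoid G) K K]

/-- For a Hecke pair, a finitely supported function on `K\G/K` pulls back to a finitely supported
function on `G ⧸ K` (Shimura, Proposition 3.1). [folklore] -/
theorem finite_support_comp_toHeckeCoset (c : HeckeCoset (⊤ : Submonoid G) K K →₀ k) :
    (Function.support fun x : G ⧸ K => c (toHeckeCoset K x)).Finite := by
  have h : (Function.support fun x : G ⧸ K => c (toHeckeCoset K x)) =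
      toHeckeCoset K ⁻¹' (c.support : Set (HeckeCoset (⊤ : Submonoid G) K K)) := by
    ext x
    simp
  rw [h]
  exact c.support.finite_toSet.preimage' fun D _ => finite_preimage_toHeckeCoset K D

/-- The `K`-invariant element of `k[G ⧸ K]` with coefficient `c(KgK)` at every `[gK]`, for a
finitely supported `c : K\G/K → k`; finitely supported because each double coset of a Hecke pair
contains finitely many left cosets. [folklore] -/
noncomputable def ofDoubleCosets (c : HeckeCoset (⊤ : Submonoid G) K K →₀ k) :
    MonoidAlgebra k (G ⧸ K) :=
  .ofCoeff (Finsupp.ofSupportFinite _ (finite_support_comp_toHeckeCoset K c))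

/-- Coefficients of `ofDoubleCosets`. [folklore] -/
@[simp]
theorem coeff_ofDoubleCosets_apply (c : HeckeCoset (⊤ : Submonoid G) K K →₀ k) (x : G ⧸ K) :
    (ofDoubleCosets K c).coeff x = c (toHeckeCoset K x) :=
  rfl

/-- `ofDoubleCosets K c` is `K`-invariant. [folklore] -/
theorem ofMulAction_ofDoubleCosets (c : HeckeCoset (⊤ : Submonoid G) K K →₀ k) (a : G)
    (ha : a ∈ K) : ofMulAction k G (G ⧸ K) a (ofDoubleCosets K c) = ofDoubleCosets K c := by
  refine MonoidAlgebra.ext (Finsupp.ext fun x => ?_)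
  rw [coeff_ofMulAction, coeff_ofDoubleCosets_apply, coeff_ofDoubleCosets_apply,
    show a⁻¹ • x = (⟨a, ha⟩⁻¹ : K) • x from rfl, toHeckeCoset_smul]

/-- `ofDoubleCosets` of the delta function at `KgK` is the characteristic element `𝟙_{KgK}`.
[folklore] -/
theorem ofDoubleCosets_single (g : G) :
    ofDoubleCosets K (Finsupp.single (HeckeCoset.mk K K ⟨g, Submonoid.mem_top g⟩) (1 : k)) =
      doubleCosetIndicator k G K g := by
  classical
  refine MonoidAlgebra.ext (Finsupp.ext fun y => ?_)
  rw [coeff_ofDoubleCosets_apply, doubleCosetIndicator,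
    finsum_mem_eq_finite_toFinset_sum _ (finite_orbit_quotient K g), MonoidAlgebra.coeff_sum,
    Finsupp.finsetSum_apply, ← toHeckeCoset_coe]
  simp only [MonoidAlgebra.coeff_single, Finsupp.single_apply, Finset.sum_ite_eq',
    Set.Finite.mem_toFinset, toHeckeCoset_eq_iff]

/-- Surjectivity of the coordinates, with the explicit preimage `extend K (ofDoubleCosets K c)`.
[folklore] -/
theorem doubleCosetCoeff_extend_ofDoubleCosets (c : HeckeCoset (⊤ : Submonoid G) K K →₀ k) :
    doubleCosetCoeff K ⟨extend K (ofDoubleCosets K c),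
      extend_mem K (ofMulAction_ofDoubleCosets K c)⟩ = c := by
  refine Finsupp.ext fun D => ?_
  rw [doubleCosetCoeff_apply]
  change (extend K (ofDoubleCosets K c) (MonoidAlgebra.single ((1 : G) : G ⧸ K) 1)).coeff
    (ofHeckeCoset K D) = c D
  obtain ⟨h, H⟩ := QuotientGroup.mk_out_eq_mul K (1 : G)
  rw [extend_single, one_smul, H, one_mul, ofMulAction_ofDoubleCosets K c _ h.2,
    coeff_ofDoubleCosets_apply, toHeckeCoset_ofHeckeCoset]

/-- **Frobenius reciprocity / double-coset coordinates**:
`ℋ(G, K) = End_G(k[G ⧸ K]) ≃ₗ[k] (K\G/K →₀ k)`, `T ↦ (KgK ↦ (T [K])(gK))`, for a Hecke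
pair (Bump 1997, Proposition 4.1.2; Shimura 1971, §3.1). [folklore] -/
noncomputable def doubleCosetCoeffEquiv :
    heckeAlgebra k G K ≃ₗ[k] (HeckeCoset (⊤ : Submonoid G) K K →₀ k) :=
  LinearEquiv.ofBijective (doubleCosetCoeff K)
    ⟨doubleCosetCoeff_injective K, fun c => ⟨_, doubleCosetCoeff_extend_ofDoubleCosets K c⟩⟩

/-- Unfolding of `doubleCosetCoeffEquiv`. [folklore] -/
theorem doubleCosetCoeffEquiv_apply (T : heckeAlgebra k G K) :
    doubleCosetCoeffEquiv K T = doubleCosetCoeff K T :=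
  rfl

/-- The inverse coordinates: `c ↦ extend K (ofDoubleCosets K c)`. [folklore] -/
theorem doubleCosetCoeffEquiv_symm_apply (c : HeckeCoset (⊤ : Submonoid G) K K →₀ k) :
    (doubleCosetCoeffEquiv K).symm c =
      ⟨extend K (ofDoubleCosets K c), extend_mem K (ofMulAction_ofDoubleCosets K c)⟩ := by
  rw [LinearEquiv.symm_apply_eq]
  exact (doubleCosetCoeff_extend_ofDoubleCosets K c).symm

end Reciprocity

end heckeAlgebra

section Discharges

variable (k G : Type*) [CommRing k] [Group G] (K : Subgroup G)
  [IsHeckeTriple (⊤ : Submonoid G) K K]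

/-- **Discharge** of `nonempty_linearEquiv_heckeRing`: `ℋ(G, K) ≃ₗ[k] (HeckeCoset ⊤ K K →₀ k)`
by the Frobenius-reciprocity coordinates `heckeAlgebra.doubleCosetCoeffEquiv`
(Shimura 1971, §3.1, p. 54: the Hecke ring `R(Γ, Δ)` is the free module on the double cosets;
Bump 1997, Proposition 4.1.2 (Mackey) for `End_G` of an induced representation).
[cite: Shimura1971, §3.1] -/
theorem nonempty_linearEquiv_heckeRing_holds : nonempty_linearEquiv_heckeRing k G K :=
  ⟨heckeAlgebra.doubleCosetCoeffEquiv K⟩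

/-- **Discharge** of `nonempty_addEquiv_heckeRing`, through `HeckeCosetModule.of`.
[cite: Shimura1971, §3.1] -/
theorem nonempty_addEquiv_heckeRing_holds : nonempty_addEquiv_heckeRing k G K :=
  ⟨(heckeAlgebra.doubleCosetCoeffEquiv K).toAddEquiv.trans
    (AddEquiv.mk' HeckeCosetModule.of fun _ _ => rfl)⟩

/-- **Discharge** of `exists_basis_heckeAlgebra`: the basis `Module.Basis.ofRepr` of the
coordinates `heckeAlgebra.doubleCosetCoeffEquiv`; its element at `KgK` is
`heckeAlgebra.extend K 𝟙_{KgK}`, which sends `[K] ↦ 𝟙_{KgK} = doubleCosetIndicator k G K g`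
(Shimura 1971, §3.1; Bump 1997, Proposition 4.1.2). [cite: Shimura1971, §3.1] -/
theorem exists_basis_heckeAlgebra_holds : exists_basis_heckeAlgebra k G K := by
  refine ⟨Module.Basis.ofRepr (heckeAlgebra.doubleCosetCoeffEquiv K), fun g => ?_⟩
  rw [Module.Basis.coe_ofRepr]
  dsimp only
  rw [heckeAlgebra.doubleCosetCoeffEquiv_symm_apply]
  change heckeAlgebra.extend K _ (MonoidAlgebra.single _ 1) = _
  obtain ⟨h, H⟩ := QuotientGroup.mk_out_eq_mul K (1 : G)
  rw [heckeAlgebra.extend_single, one_smul, H, one_mul,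
    heckeAlgebra.ofMulAction_ofDoubleCosets K _ _ h.2, heckeAlgebra.ofDoubleCosets_single]

end Discharges

end Literature.NumberTheory.Automorphic
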